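import Mathlib
import HarnessLib
import Summits.Langlands.Langlands.Theses.ParityBlindBianchi
import Summits.Langlands.Langlands.Theses.RuelleTorsionArtinWeight
import Summits.Langlands.Langlands.Theorems.ParityBlindBianchiArtinWeightRealisationLevelCuspFormsDischarged
import Literature.NumberTheory.Automorphic.CaraianiNewtonModularity
import Literature.NumberTheory.Automorphic.PiOfArtinRepAtSigmaUnramifiedPlaces
import Literature.NumberTheory.Automorphic.StrongArtinGL2

/-!
# Crux stmt-Langlands-15111 (`ParityBlindBianchi.ArtinWeightRealisationLevel`, R′) — round-2 crux
# idea `cap-wall-patching-e5-door`: FIRST LEMMAS (sketch, not a skeleton)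

Ideator planner-cruxidea-stmt-Langlands-15111-4-0, 2026-08-17.  `lean check` target: rc 0, sorries
only none (pure definitions + a checked composition).

The card's line shape (all stubs over existing declarations; the hypothesis package H of the crux is
NOT consumed — see the card's `Disproof used:` / `Transfer:`):

  `E5Door` (AKT23 Prop. 9.13 / CaraianiNewton2023 Prop. 6.1.5 + Lemma 6.1.4: residual anchor at 5
     for EVERY insoluble finite-image σ over a totally complex field, over a solvable CM extension L,
     by a MODULAR elliptic curve E/L with r̄_{E,5} ≅ σ̄|_L ⊗ χ̄)
  → `CAPWallHost` (THE NEW CRUX: Calegari–Geraghty / BCGP-shape patching of CLASSICAL higher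
     coherent cohomology of the U(2,2)/L⁺ Shimura variety at the scalar-weight-2 wall, localised at
     the CAP/Yoshida ideal of the anchor, ⇒ the Artin–CAP pseudocharacter is the eigensystem of a
     classical coherent class ⇒ (Harris–Zucker + Mok weak base change) the GL₄/L host pattern)
  → `GL4HostExit` (the sibling card's theorem-level exit by cuspidal support, verbatim)
  → `SolvableArtinDescentAE` (Langlands 1980 / Arthur–Clozel cyclic descent bootstrapping, in print)
  → insoluble core of R a.e. WITHOUT the occurrence hypothesis (`insolubleAE_of_cards`, checked)
  → R′ BY NAME through the landed kit `artinWeightRealisationLevel_of_artinWeightRealisation_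
     insoluble_of_gelbart` (p115022) + Langlands–Tunnell + Gelbart 4.1 σ-shadow
     (`ArtinWeightRealisationLevel_of_cards`, checked).
-/

noncomputable section

open scoped BigOperators Topology Classical Matrix Polynomial NumberField
open Filter Set Function
open Literature.NumberTheory.Automorphic Literature.NumberTheory.GaloisRepresentations
  IsDedekindDomain

set_option linter.dupNamespace false

namespace Summit.Langlands.Langlands.Cruxes.ArtinWeightRealisationLevel.CapWallPatchingE5

/-- `5` is prime (instance needed to speak of `ℚ̄₅ = PadicAlgCl 5`). [folklore] -/
instance fact_prime_five : Fact (Nat.Prime 5) := ⟨by norm_num⟩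

/-! ## 1. The E[5]-door (residual anchor at p = 5, in print) -/

/-- **Door output over `L`** for a finite-image `σ : Γ_K → GL₂(ℚ̄_p)` (any `p`, `ι : ℚ̄_p ≃ ℂ`):
an integral Weierstrass model `E` over `𝓞 L` of an elliptic curve (`Δ ≠ 0`) which is MODULAR in
Caraiani–Newton's sense, a finite-order character `χ : Γ_L → ℚ̄_pˣ` and a field isomorphism
`ι₅ : ℚ̄₅ ≃ ℂ` such that at all but finitely many places `w` of `L` the trace of `σ|_L(Frob_w)` is
congruent, modulo the maximal ideal of `ℤ̄₅` (read through `ι₅⁻¹ ∘ ι`), to `χ(Frob_w) · a_w(E)` —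
the cofinite trace shadow of `r̄_{E,5} ≅ σ̄|_L ⊗ χ̄`. (Conventions: `P = X² − tr·X + det` is the
arithmetic-Frobenius polynomial of `σ|_L`, `Q = X − χ(Frob_w)`, so `−P.coeff 1 = tr`,
`−Q.coeff 0 = χ(Frob_w)`.) -/
def DoorOutput (K : Type) [Field K] [NumberField K] (p : ℕ) [Fact p.Prime]
    (ι : PadicAlgCl p ≃+* ℂ) (σ : FramedGaloisRep K (PadicAlgCl p) 2)
    (L : Type) [Field L] [NumberField L] [Algebra K L] : Prop :=
  ∃ (E : WeierstrassCurve (𝓞 L)) (χ : FramedGaloisRep L (PadicAlgCl p) 1)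
    (ι₅ : PadicAlgCl 5 ≃+* ℂ),
    E.Δ ≠ 0 ∧ IsModularEllipticCurve L E ∧ Finite χ.toMonoidHom.range ∧
      ∀ᶠ w : HeightOneSpectrum (𝓞 L) in cofinite,
        ∃ (P Q : Polynomial (PadicAlgCl p)),
          (σ.restrictField L).IsUnramifiedAt w ∧ (σ.restrictField L).HasFrobCharpolyAt w P ∧
            χ.IsUnramifiedAt w ∧ χ.HasFrobCharpolyAt w Q ∧
              ‖ι₅.symm (ι (P.coeff 1) - ι (Q.coeff 0) * (frobTraceAt E w : ℂ))‖ < 1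

/-- **E5Door** (Shepherd-Barron–Taylor / Allen–Khare–Thorne Prop. 9.13 / Caraiani–Newton
Prop. 6.1.5 + Lemma 6.1.4 + Thm. 6.1, packaged): for `K` totally complex and `σ : Γ_K → GL₂(ℚ̄_p)`
continuous with finite image, irreducible, with INSOLUBLE projective image (equivalently projective
image `A₅`), there is a finite Galois extension `L/K`, SOLVABLE and totally complex, over which `σ`
stays irreducible with insoluble projective image (`L` linearly disjoint from the `A₅`-field: their
`F^{avoid}`), carrying a door output: a modular `E/L` whose mod-`5` representation is `σ̄|_L ⊗ χ̄`.
Printed ingredients: twist `σ̄₅` into `GL₂(𝔽₅)` with cyclotomic determinant over a solvable `L`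
(projective image `PSL₂(𝔽₅)`); `X_{σ̄}(5) ≅ ℙ¹_L` has points with prescribed `5`-adic behaviour
(good ORDINARY reduction above `5` can be imposed — used by `CAPWallHost`, not recorded here);
`E` is modular by AKT23 Prop. 9.12 / CN Thm. 6.1 (2). [AKT23 §9; CaraianiNewton2023 §6.1] -/
def E5Door : Prop :=
  ∀ (K : Type) [Field K] [NumberField K], NumberField.IsTotallyComplex K →
    ∀ (p : ℕ) [Fact p.Prime] (ι : PadicAlgCl p ≃+* ℂ) (σ : FramedGaloisRep K (PadicAlgCl p) 2),
      Finite σ.toMonoidHom.range → σ.toGaloisRep.IsIrreducible →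
        ¬ IsSolvable (projectiveImage σ.toMonoidHom) →
          ∃ (L : Type) (_ : Field L) (_ : NumberField L) (_ : Algebra K L) (_ : IsGalois K L),
            IsSolvable (L ≃ₐ[K] L) ∧ NumberField.IsTotallyComplex L ∧
              Finite (σ.restrictField L).toMonoidHom.range ∧
              (σ.restrictField L).toGaloisRep.IsIrreducible ∧
              ¬ IsSolvable (projectiveImage (σ.restrictField L).toMonoidHom) ∧
                DoorOutput K p ι σ L

/-! ## 2. The GL₄-level host pattern and the exit (verbatim from the sibling card, any number field) -/

/-- **Host pattern** over a number field `L` (the sibling card `weight-two-eisenstein-host`'s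
`GL4HostPattern`, verbatim): an automorphic representation `Θ` of `GL₄(𝔸_L)` — ANY irreducible
constituent of the space of automorphic forms — whose Satake multiset at a.e. `v` is
`A·q_v^{-1/2} ⊎ B·q_v^{1/2}` with `B` unitary and `A` carrying the arithmetic-Frobenius
polynomial of `σ`: the scalar-weight-2 Siegel–Eisenstein / CAP shape `(σψ) ⊠ S₂` read on `GL₄/L`. -/
def GL4HostPattern (L : Type) [Field L] [NumberField L] (p : ℕ) [Fact p.Prime]
    (ι : PadicAlgCl p ≃+* ℂ) (σ : FramedGaloisRep L (PadicAlgCl p) 2) : Prop :=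
  ∃ (hcpt4 : isCompact_glFiniteIntegralLevel 4 L)
    (Θ : AutomorphicRepData (AutomorphyDatum.gl 4 L hcpt4)),
    ∀ᶠ v : HeightOneSpectrum (𝓞 L) in cofinite, ∃ A B : Multiset ℂ,
      Θ.HasSatakeParamAt v
          (A.map (fun a ↦ a * (((Real.sqrt (v.residueCard : ℝ) : ℝ) : ℂ))⁻¹) +
            B.map (fun b ↦ b * ((Real.sqrt (v.residueCard : ℝ) : ℝ) : ℂ))) ∧
        (∀ b ∈ B, ‖b‖ = 1) ∧
        σ.IsUnramifiedAt v ∧ σ.HasFrobCharpolyAt v (arithFrobPolyOfSatake ι v.residueCard 1 A)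

/-- **EXIT** (sibling card's `GL4HostExit`, verbatim; theorem-level: Langlands 1979 Prop. 2 cuspidal
support + Jacquet–Shalika bounds + unitarity of central characters + Chebotarev/Brauer–Nesbitt). -/
def GL4HostExit : Prop :=
  ∀ (L : Type) [Field L] [NumberField L] (p : ℕ) [Fact p.Prime] (ι : PadicAlgCl p ≃+* ℂ)
    (σ : FramedGaloisRep L (PadicAlgCl p) 2), Finite σ.toMonoidHom.range →
      σ.toGaloisRep.IsIrreducible → GL4HostPattern L p ι σ →
        ∃ (hcpt : isCompact_glFiniteIntegralLevel 2 L) (π : CuspidalAutomorphicRepData 2 L hcpt),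
          ∀ᶠ w : HeightOneSpectrum (𝓞 L) in cofinite, Summit.Langlands.SatakeFrobCompatibleAt ι π.1 σ w

/-! ## 3. THE NEW CRUX: patching classical higher coherent cohomology at the CAP wall -/

/-- **CAPWallHost** (the card's load-bearing stub, = Transfer C⁺ restricted to anchored σ): for a
totally complex `L`, solvable Galois over a totally complex `K`, and `σ : Γ_K → GL₂(ℚ̄_p)` of finite
image with `σ|_L` irreducible of insoluble projective image, a DOOR OUTPUT over `L` (modular `E/L`
with `r̄_{E,5} ≅ σ̄|_L ⊗ χ̄`) yields the GL₄/L HOST PATTERN for `σ|_L`.  Informal content: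
Calegari–Geraghty patching (BCGP-shape) of the ordinary HIGHER HIDA complexes of the `U(2,2)/L⁺`
Shimura variety at the scalar-weight-2 wall (Hodge–Tate `{0,0,1,1}`), localised at the maximal ideal
of the CAP / Yoshida lift of the anchor `(π_E ⊗ ψ₁, π_E^{c∨} ⊗ ψ₂)`, gives
`R^{pol, P-ord, wall}_{𝔪̃} = 𝕋(RΓ_{higher-Hida, wall})_{𝔪̃}`; the Artin–CAP pseudocharacter
`tr(σ|_L ψ) + tr((σ|_L ψ)^{c∨}(1))` is a de Rham, `P_{2,2}`-ordinary point of `R`, hence the eigensystem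
of a CLASSICAL coherent class (classicality is built in: one patches classical cohomology), which
Harris–Zucker + Mok weak base change transfer to the stated `Θ` on `GL₄/L`. -/
def CAPWallHost : Prop :=
  ∀ (K : Type) [Field K] [NumberField K], NumberField.IsTotallyComplex K →
    ∀ (p : ℕ) [Fact p.Prime] (ι : PadicAlgCl p ≃+* ℂ) (σ : FramedGaloisRep K (PadicAlgCl p) 2)
      (L : Type) [Field L] [NumberField L] [Algebra K L] [IsGalois K L],
      IsSolvable (L ≃ₐ[K] L) → NumberField.IsTotallyComplex L →
        Finite (σ.restrictField L).toMonoidHom.range →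
          (σ.restrictField L).toGaloisRep.IsIrreducible →
            ¬ IsSolvable (projectiveImage (σ.restrictField L).toMonoidHom) →
              DoorOutput K p ι σ L → GL4HostPattern L p ι (σ.restrictField L)

/-! ## 4. Solvable descent of a.e. automorphy for insoluble Artin σ (in print) -/

/-- **SolvableArtinDescentAE** (Langlands 1980 base change, bootstrapped along a cyclic tower of
`L/K`; Arthur–Clozel III.4.2; the matching step as in Tunnell 1981 / Taylor 2003 §end): if
`σ : Γ_K → GL₂(ℚ̄_p)` has finite image, is irreducible with insoluble projective image, `L/K` is
finite Galois solvable and `σ|_L` is Satake–Frobenius compatible a.e. with a cuspidal `π_L` on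
`GL₂(𝔸_L)`, then `σ` is Satake–Frobenius compatible a.e. with a cuspidal `π` on `GL₂(𝔸_K)`.
(Tree: `cuspidal_descent_cyclic`, strong multiplicity one; insolubility keeps `σ` irreducible on
every layer and kills the twist ambiguity via determinants at one auxiliary place.) -/
def SolvableArtinDescentAE : Prop :=
  ∀ (K : Type) [Field K] [NumberField K] (p : ℕ) [Fact p.Prime] (ι : PadicAlgCl p ≃+* ℂ)
    (σ : FramedGaloisRep K (PadicAlgCl p) 2) (L : Type) [Field L] [NumberField L] [Algebra K L]
    [IsGalois K L], IsSolvable (L ≃ₐ[K] L) → Finite σ.toMonoidHom.range →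
      σ.toGaloisRep.IsIrreducible → ¬ IsSolvable (projectiveImage σ.toMonoidHom) →
        (∃ (hcptL : isCompact_glFiniteIntegralLevel 2 L) (πL : CuspidalAutomorphicRepData 2 L hcptL),
          ∀ᶠ w : HeightOneSpectrum (𝓞 L) in cofinite,
            Summit.Langlands.SatakeFrobCompatibleAt ι πL.1 (σ.restrictField L) w) →
        ∃ (hcpt : isCompact_glFiniteIntegralLevel 2 K) (π : CuspidalAutomorphicRepData 2 K hcpt),
          ∀ᶠ v : HeightOneSpectrum (𝓞 K) in cofinite, Summit.Langlands.SatakeFrobCompatibleAt ι π.1 σ v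

/-! ## 5. Checked compositions -/

/-- **Insoluble Artin over totally complex fields, a.e., WITHOUT any p-adic occurrence hypothesis**
(the Transfer C⁺ of the card, as the conjunction of its stubs delivers it): for `K` totally complex
and `σ` finite-image irreducible with insoluble projective image, some cuspidal `π` on `GL₂(𝔸_K)`
is Satake–Frobenius compatible with `σ` at a.e. place. -/
def InsolubleArtinAE : Prop :=
  ∀ (K : Type) [Field K] [NumberField K], NumberField.IsTotallyComplex K →
    ∀ (p : ℕ) [Fact p.Prime] (ι : PadicAlgCl p ≃+* ℂ) (σ : FramedGaloisRep K (PadicAlgCl p) 2),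
      Finite σ.toMonoidHom.range → σ.toGaloisRep.IsIrreducible →
        ¬ IsSolvable (projectiveImage σ.toMonoidHom) →
          ∃ (hcpt : isCompact_glFiniteIntegralLevel 2 K) (π : CuspidalAutomorphicRepData 2 K hcpt),
            ∀ᶠ v : HeightOneSpectrum (𝓞 K) in cofinite, Summit.Langlands.SatakeFrobCompatibleAt ι π.1 σ v

/-- **Composition (checked): door → wall → exit → descent ⊢ insoluble Artin a.e.** [folklore] -/
theorem insolubleAE_of_cards (hDoor : E5Door) (hWall : CAPWallHost) (hExit : GL4HostExit)
    (hDesc : SolvableArtinDescentAE) : InsolubleArtinAE := by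
  intro K _ _ hK p _ ι σ hfin hirr hins
  obtain ⟨L, _, _, _, _, hsolv, hL, hfinL, hirrL, hinsL, hOut⟩ := hDoor K hK p ι σ hfin hirr hins
  have hHost : GL4HostPattern L p ι (σ.restrictField L) :=
    hWall K hK p ι σ L hsolv hL hfinL hirrL hinsL hOut
  obtain ⟨hcptL, πL, hπL⟩ := hExit L p ι (σ.restrictField L) hfinL hirrL hHost
  exact hDesc K p ι σ L hsolv hfin hirr hins ⟨hcptL, πL, hπL⟩

/-- **The crux BY NAME from the card's stubs** (plus the two classical named facts the landed
closing kit already isolates: Langlands–Tunnell `strongArtin_of_isSolvable` for the solvable sector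
and the Gelbart 1997 Prop. 4.1 σ-unramified shadow `frobSatakeCompatibleAt_of_isPiOfArtinRep_of_
isUnramifiedAt` for "a.e. ⇒ every good place"), through the accepted
`artinWeightRealisationLevel_of_artinWeightRealisation_insoluble_of_gelbart` (p115022).  The
occurrence hypothesis of R′ is discarded at the insoluble core (the card's point: it is a transport
ticket only). [folklore] -/
theorem ArtinWeightRealisationLevel_of_cards (hDoor : E5Door) (hWall : CAPWallHost)
    (hExit : GL4HostExit) (hDesc : SolvableArtinDescentAE)
    (hLT : strongArtin_of_isSolvable)
    (hG : frobSatakeCompatibleAt_of_isPiOfArtinRep_of_isUnramifiedAt) :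
    Summit.Langlands.Langlands.Theses.ParityBlindBianchi.ArtinWeightRealisationLevel := by
  refine Summit.Langlands.Langlands.Theorems.ArtinWeightRealisationLevel.artinWeightRealisationLevel_of_artinWeightRealisation_insoluble_of_gelbart
    hLT hG ?_
  intro K _ _ hK h2 p _ ι σ hfin hirr hins _hocc
  exact insolubleAE_of_cards hDoor hWall hExit hDesc K hK p ι σ hfin hirr hins

/-- Sanity: the same stubs also give the SHARED a.e. crux R (item stmt-Langlands-11057) — the two
cruxes are kernel-equivalent modulo Gelbart 4.1 (p115022/p121004), so a mechanism for one is a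
mechanism for both; recorded so that triage can see the card is not routed THROUGH item 11057. -/
theorem ArtinWeightRealisation_of_cards (hDoor : E5Door) (hWall : CAPWallHost)
    (hExit : GL4HostExit) (hDesc : SolvableArtinDescentAE) (hLT : strongArtin_of_isSolvable) :
    Summit.Langlands.Langlands.Theses.RuelleTorsionArtinWeight.ArtinWeightRealisation := by
  refine Summit.Langlands.Langlands.Theorems.ArtinWeightRealisationLevel.artinWeightRealisation_of_insoluble_sector hLT ?_
  intro K _ _ hK h2 p _ ι σ hfin hirr hins _hocc
  exact insolubleAE_of_cards hDoor hWall hExit hDesc K hK p ι σ hfin hirr hins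

end Summit.Langlands.Langlands.Cruxes.ArtinWeightRealisationLevel.CapWallPatchingE5

end
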